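import Literature.Analysis.FunctionSpaces.TorusCalculusProofs
import Literature.Analysis.FunctionSpaces.TorusTestFunction
import HarnessLib

/-!
# Low-order Leibniz commutators and chain rules for partial derivatives on the flat torus

Analysis/FunctionSpaces support file (everything proved; no named facts). The energy method for
quasilinear symmetric hyperbolic systems (Majda 1984, Ch. 2 §2.1, Thms 2.1–2.2; Kato 1975)
differentiates the equations `∂ₜU + ∑ⱼ Aⱼ(U)∂ⱼU = 0` up to the order `s` of the energy and
estimates the commutators `∂^α(A ∂ⱼU) - A ∂^α∂ⱼU` and the derivatives of the composite
coefficients `A(U)` (Moser-type calculus, Majda 1984, Prop. 2.1). For the `H³` theory on `𝕋³`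
only orders `|α| ≤ 3` occur, and this file records the corresponding EXPLICIT formulas for
torus functions (`Torus.partialDeriv`), avoiding multi-index bookkeeping:

* Leibniz commutators of orders 1, 2, 3 for scalar multiples `f • g` (`partialDeriv_smul_sub`,
  `partialDeriv₂_smul_sub`, `partialDeriv₃_smul_sub`) and products `f * g`
  (`partialDeriv_mul_sub`, `partialDeriv₂_mul_sub`, `partialDeriv₃_mul_sub`);
* the chain rule along coordinate lines for `φ ∘ w` with `φ : ℝ → ℝ` smooth on an open set
  containing the range of `w` (`IsSmooth.comp_of_contDiffOn`, `partialDeriv_comp_of_contDiffOn`)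
  and its iterates of orders 2 and 3 (`partialDeriv₂_comp`, `partialDeriv₃_comp`);
* the resulting pointwise bounds in terms of bounds for `φ', φ'', φ'''` on the range
  (`abs_partialDeriv_comp_le`, `abs_partialDeriv₂_comp_le`, `abs_partialDeriv₃_comp_le`).

## References

* A. Majda, *Compressible Fluid Flow and Systems of Conservation Laws in Several Space
  Variables*, Springer 1984, Ch. 2 §2.1, Prop. 2.1, Thms 2.1–2.2. [`Majda1984`]
-/

noncomputable section

open Set Function
open scoped ContDiff

namespace Literature.Analysis.FunctionSpaces

namespace Torus

variable {d : Type*} [Fintype d] [DecidableEq d]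
variable {F : Type*} [NormedAddCommGroup F] [NormedSpace ℝ F]

/-! ## Leibniz commutators of orders one, two and three -/

section Leibniz

variable {f : UnitAddTorus d → ℝ} {g : UnitAddTorus d → F}

/-- Order one: `∂ᵢ(f • g) - f • ∂ᵢg = ∂ᵢf • g`. [folklore] -/
theorem partialDeriv_smul_sub (hf : IsSmooth f) (hg : IsSmooth g) (i : d) (x : UnitAddTorus d) :
    partialDeriv i (fun y => f y • g y) x - f x • partialDeriv i g x = partialDeriv i f x • g x := by
  rw [partialDeriv_smul (hf.isContDiff (by simp)) (hg.isContDiff (by simp))]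
  abel

/-- The first derivative of a scalar multiple as a function:
`∂ᵢ(f • g) = f • ∂ᵢg + ∂ᵢf • g`. [folklore] -/
theorem partialDeriv_smul_fun (hf : IsSmooth f) (hg : IsSmooth g) (i : d) :
    partialDeriv i (fun y => f y • g y) =
      fun x => f x • partialDeriv i g x + partialDeriv i f x • g x :=
  funext fun x => partialDeriv_smul (hf.isContDiff (by simp)) (hg.isContDiff (by simp)) i x

/-- Order two: `∂ⱼ∂ᵢ(f • g) - f • ∂ⱼ∂ᵢg = ∂ⱼ∂ᵢf • g + ∂ᵢf • ∂ⱼg + ∂ⱼf • ∂ᵢg`. [folklore] -/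
theorem partialDeriv₂_smul_sub (hf : IsSmooth f) (hg : IsSmooth g) (i j : d) (x : UnitAddTorus d) :
    partialDeriv j (partialDeriv i (fun y => f y • g y)) x - f x • partialDeriv j (partialDeriv i g) x =
      partialDeriv j (partialDeriv i f) x • g x + partialDeriv i f x • partialDeriv j g x +
        partialDeriv j f x • partialDeriv i g x := by
  rw [partialDeriv_smul_fun hf hg i]
  have e : (fun x => f x • partialDeriv i g x + partialDeriv i f x • g x) =
      (fun x => f x • partialDeriv i g x) + fun x => partialDeriv i f x • g x := rfl
  rw [e, partialDeriv_add ((hf.smul' (hg.partialDeriv i)).isContDiff (by simp))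
    (((hf.partialDeriv i).smul' hg).isContDiff (by simp)), Pi.add_apply,
    partialDeriv_smul (hf.isContDiff (by simp)) ((hg.partialDeriv i).isContDiff (by simp)),
    partialDeriv_smul ((hf.partialDeriv i).isContDiff (by simp)) (hg.isContDiff (by simp))]
  abel

/-- The second derivative of a scalar multiple as a function. [folklore] -/
theorem partialDeriv₂_smul_fun (hf : IsSmooth f) (hg : IsSmooth g) (i j : d) :
    partialDeriv j (partialDeriv i (fun y => f y • g y)) =
      fun x => f x • partialDeriv j (partialDeriv i g) x + (partialDeriv j (partialDeriv i f) x • g x +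
        partialDeriv i f x • partialDeriv j g x + partialDeriv j f x • partialDeriv i g x) := by
  funext x
  rw [← partialDeriv₂_smul_sub hf hg i j x]
  abel

/-- Order three:
`∂ₖ∂ⱼ∂ᵢ(f • g) - f • ∂ₖ∂ⱼ∂ᵢg = ∂ₖ∂ⱼ∂ᵢf • g + ∂ⱼ∂ᵢf • ∂ₖg + ∂ₖ∂ᵢf • ∂ⱼg + ∂ᵢf • ∂ₖ∂ⱼg
  + ∂ₖ∂ⱼf • ∂ᵢg + ∂ⱼf • ∂ₖ∂ᵢg + ∂ₖf • ∂ⱼ∂ᵢg`. [folklore] -/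
theorem partialDeriv₃_smul_sub (hf : IsSmooth f) (hg : IsSmooth g) (i j k : d) (x : UnitAddTorus d) :
    partialDeriv k (partialDeriv j (partialDeriv i (fun y => f y • g y))) x -
        f x • partialDeriv k (partialDeriv j (partialDeriv i g)) x =
      partialDeriv k (partialDeriv j (partialDeriv i f)) x • g x +
        partialDeriv j (partialDeriv i f) x • partialDeriv k g x +
        partialDeriv k (partialDeriv i f) x • partialDeriv j g x +
        partialDeriv i f x • partialDeriv k (partialDeriv j g) x +
        partialDeriv k (partialDeriv j f) x • partialDeriv i g x +
        partialDeriv j f x • partialDeriv k (partialDeriv i g) x +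
        partialDeriv k f x • partialDeriv j (partialDeriv i g) x := by
  have hfi := hf.partialDeriv i
  have hfj := hf.partialDeriv j
  have hgi := hg.partialDeriv i
  have hgj := hg.partialDeriv j
  have hfji := hfi.partialDeriv j
  have hgji := hgi.partialDeriv j
  rw [partialDeriv₂_smul_fun hf hg i j]
  have h1 : IsSmooth (fun x => f x • partialDeriv j (partialDeriv i g) x) := hf.smul' hgji
  have h2 : IsSmooth (fun x => partialDeriv j (partialDeriv i f) x • g x) := hfji.smul' hg
  have h3 : IsSmooth (fun x => partialDeriv i f x • partialDeriv j g x) := hfi.smul' hgj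
  have h4 : IsSmooth (fun x => partialDeriv j f x • partialDeriv i g x) := hfj.smul' hgi
  have e : (fun x => f x • partialDeriv j (partialDeriv i g) x + (partialDeriv j (partialDeriv i f) x • g x +
      partialDeriv i f x • partialDeriv j g x + partialDeriv j f x • partialDeriv i g x)) =
      (fun x => f x • partialDeriv j (partialDeriv i g) x) + ((fun x => partialDeriv j (partialDeriv i f) x • g x) +
        (fun x => partialDeriv i f x • partialDeriv j g x) + (fun x => partialDeriv j f x • partialDeriv i g x)) := by
    funext x; simp only [Pi.add_apply]
  rw [e, partialDeriv_add (h1.isContDiff (by simp)) (((h2.add h3).add h4).isContDiff (by simp)),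
    partialDeriv_add ((h2.add h3).isContDiff (by simp)) (h4.isContDiff (by simp)),
    partialDeriv_add (h2.isContDiff (by simp)) (h3.isContDiff (by simp))]
  simp only [Pi.add_apply]
  rw [show partialDeriv k (fun x => f x • partialDeriv j (partialDeriv i g) x) x = _ from
      partialDeriv_smul (hf.isContDiff (by simp)) (hgji.isContDiff (by simp)) k x,
    show partialDeriv k (fun x => partialDeriv j (partialDeriv i f) x • g x) x = _ from
      partialDeriv_smul (hfji.isContDiff (by simp)) (hg.isContDiff (by simp)) k x,
    show partialDeriv k (fun x => partialDeriv i f x • partialDeriv j g x) x = _ from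
      partialDeriv_smul (hfi.isContDiff (by simp)) (hgj.isContDiff (by simp)) k x,
    show partialDeriv k (fun x => partialDeriv j f x • partialDeriv i g x) x = _ from
      partialDeriv_smul (hfj.isContDiff (by simp)) (hgi.isContDiff (by simp)) k x]
  abel

variable {g' : UnitAddTorus d → ℝ}

/-- Order one, products: `∂ᵢ(f g) - f ∂ᵢg = ∂ᵢf · g`. [folklore] -/
theorem partialDeriv_mul_sub (hf : IsSmooth f) (hg : IsSmooth g') (i : d) (x : UnitAddTorus d) :
    partialDeriv i (fun y => f y * g' y) x - f x * partialDeriv i g' x = partialDeriv i f x * g' x := by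
  have h := partialDeriv_smul_sub hf hg i x
  simpa only [smul_eq_mul] using h

/-- Order two, products. [folklore] -/
theorem partialDeriv₂_mul_sub (hf : IsSmooth f) (hg : IsSmooth g') (i j : d) (x : UnitAddTorus d) :
    partialDeriv j (partialDeriv i (fun y => f y * g' y)) x - f x * partialDeriv j (partialDeriv i g') x =
      partialDeriv j (partialDeriv i f) x * g' x + partialDeriv i f x * partialDeriv j g' x +
        partialDeriv j f x * partialDeriv i g' x := by
  have h := partialDeriv₂_smul_sub hf hg i j x
  simpa only [smul_eq_mul] using h

/-- Order three, products. [folklore] -/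
theorem partialDeriv₃_mul_sub (hf : IsSmooth f) (hg : IsSmooth g') (i j k : d) (x : UnitAddTorus d) :
    partialDeriv k (partialDeriv j (partialDeriv i (fun y => f y * g' y))) x -
        f x * partialDeriv k (partialDeriv j (partialDeriv i g')) x =
      partialDeriv k (partialDeriv j (partialDeriv i f)) x * g' x +
        partialDeriv j (partialDeriv i f) x * partialDeriv k g' x +
        partialDeriv k (partialDeriv i f) x * partialDeriv j g' x +
        partialDeriv i f x * partialDeriv k (partialDeriv j g') x +
        partialDeriv k (partialDeriv j f) x * partialDeriv i g' x +
        partialDeriv j f x * partialDeriv k (partialDeriv i g') x +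
        partialDeriv k f x * partialDeriv j (partialDeriv i g') x := by
  have h := partialDeriv₃_smul_sub hf hg i j k x
  simpa only [smul_eq_mul] using h

end Leibniz

/-! ## Chain rule along coordinate lines for `φ ∘ w`, `φ` smooth near the range of `w` -/

section Chain

variable {φ : ℝ → ℝ} {V : Set ℝ} {w : UnitAddTorus d → ℝ}

omit [DecidableEq d] in
/-- A composite `φ ∘ w` with `w` smooth on the torus and `φ` smooth on an open set containing
the range of `w` is smooth. [folklore] -/
theorem IsSmooth.comp_of_contDiffOn (hφ : ContDiffOn ℝ ∞ φ V) (hw : IsSmooth w)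
    (hwV : ∀ x, w x ∈ V) : IsSmooth (fun y => φ (w y)) := by
  have h : lift (fun y => φ (w y)) = φ ∘ lift w := by funext v; rfl
  unfold IsSmooth
  rw [h]
  exact hφ.comp_contDiff hw fun v => hwV _

/-- **Chain rule along coordinate lines**: `∂ᵢ(φ ∘ w)(x) = φ'(w x) ∂ᵢw(x)` when `φ` is
differentiable at `w x` and `w` is `C¹`. [folklore] -/
theorem partialDeriv_comp_of_differentiableAt {x : UnitAddTorus d} (hφ : DifferentiableAt ℝ φ (w x))
    (hw : IsContDiff 1 w) (i : d) :
    partialDeriv i (fun z => φ (w z)) x = deriv φ (w x) * partialDeriv i w x := by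
  have hin := hasDerivAt_comp_add_proj_smul hw x (EuclideanSpace.single i (1 : ℝ)) 0
  have hx0 : x + proj ((0 : ℝ) • EuclideanSpace.single i (1 : ℝ)) = x := by
    rw [zero_smul, proj_zero, add_zero]
  rw [hx0] at hin
  have h := (hφ.hasDerivAt).comp_of_eq (0 : ℝ) hin (by simp only [zero_smul, proj_zero, add_zero])
  change deriv (fun t : ℝ => φ (w (x + proj (t • EuclideanSpace.single i (1 : ℝ))))) 0 =
    deriv φ (w x) * deriv (fun t : ℝ => w (x + proj (t • EuclideanSpace.single i (1 : ℝ)))) 0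
  rw [hin.deriv]
  exact h.deriv

/-- The chain rule for `φ` smooth on an open set `V ∋ w x`, `w` smooth. [folklore] -/
theorem partialDeriv_comp_of_contDiffOn (hφ : ContDiffOn ℝ ∞ φ V) (hV : IsOpen V) (hw : IsSmooth w)
    (hwV : ∀ x, w x ∈ V) (i : d) (x : UnitAddTorus d) :
    partialDeriv i (fun z => φ (w z)) x = deriv φ (w x) * partialDeriv i w x :=
  partialDeriv_comp_of_differentiableAt
    ((hφ.contDiffAt (hV.mem_nhds (hwV x))).differentiableAt (by simp)) (hw.isContDiff (by simp)) i

/-- The chain rule as an identity of functions: `∂ᵢ(φ ∘ w) = (φ' ∘ w) · ∂ᵢw`. [folklore] -/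
theorem partialDeriv_comp_fun (hφ : ContDiffOn ℝ ∞ φ V) (hV : IsOpen V) (hw : IsSmooth w)
    (hwV : ∀ x, w x ∈ V) (i : d) :
    partialDeriv i (fun z => φ (w z)) = fun x => deriv φ (w x) * partialDeriv i w x :=
  funext fun x => partialDeriv_comp_of_contDiffOn hφ hV hw hwV i x

/-- The derivative of a function smooth on an open set is smooth there. [folklore] -/
theorem contDiffOn_deriv_of_isOpen (hφ : ContDiffOn ℝ ∞ φ V) (hV : IsOpen V) :
    ContDiffOn ℝ ∞ (deriv φ) V :=
  hφ.deriv_of_isOpen hV (by simp)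

/-- **Second-order chain rule**: `∂ⱼ∂ᵢ(φ ∘ w) = φ''(w) ∂ⱼw ∂ᵢw + φ'(w) ∂ⱼ∂ᵢw`. [folklore] -/
theorem partialDeriv₂_comp (hφ : ContDiffOn ℝ ∞ φ V) (hV : IsOpen V) (hw : IsSmooth w)
    (hwV : ∀ x, w x ∈ V) (i j : d) (x : UnitAddTorus d) :
    partialDeriv j (partialDeriv i (fun z => φ (w z))) x =
      deriv (deriv φ) (w x) * partialDeriv j w x * partialDeriv i w x +
        deriv φ (w x) * partialDeriv j (partialDeriv i w) x := by
  have hφ' := contDiffOn_deriv_of_isOpen hφ hV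
  have h1 : IsSmooth (fun y => deriv φ (w y)) := IsSmooth.comp_of_contDiffOn hφ' hw hwV
  rw [partialDeriv_comp_fun hφ hV hw hwV i,
    partialDeriv_mul (h1.isContDiff (by simp)) ((hw.partialDeriv i).isContDiff (by simp)),
    partialDeriv_comp_of_contDiffOn hφ' hV hw hwV j x]
  ring

/-- The second-order chain rule as an identity of functions. [folklore] -/
theorem partialDeriv₂_comp_fun (hφ : ContDiffOn ℝ ∞ φ V) (hV : IsOpen V) (hw : IsSmooth w)
    (hwV : ∀ x, w x ∈ V) (i j : d) :
    partialDeriv j (partialDeriv i (fun z => φ (w z))) =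
      fun x => deriv (deriv φ) (w x) * partialDeriv j w x * partialDeriv i w x +
        deriv φ (w x) * partialDeriv j (partialDeriv i w) x :=
  funext fun x => partialDeriv₂_comp hφ hV hw hwV i j x

/-- **Third-order chain rule**:
`∂ₖ∂ⱼ∂ᵢ(φ ∘ w) = φ‴(w) ∂ₖw ∂ⱼw ∂ᵢw + φ″(w) (∂ₖ∂ⱼw ∂ᵢw + ∂ⱼw ∂ₖ∂ᵢw + ∂ₖw ∂ⱼ∂ᵢw) + φ′(w) ∂ₖ∂ⱼ∂ᵢw`.
[folklore] -/
theorem partialDeriv₃_comp (hφ : ContDiffOn ℝ ∞ φ V) (hV : IsOpen V) (hw : IsSmooth w)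
    (hwV : ∀ x, w x ∈ V) (i j k : d) (x : UnitAddTorus d) :
    partialDeriv k (partialDeriv j (partialDeriv i (fun z => φ (w z)))) x =
      deriv (deriv (deriv φ)) (w x) * partialDeriv k w x * partialDeriv j w x * partialDeriv i w x +
        deriv (deriv φ) (w x) * (partialDeriv k (partialDeriv j w) x * partialDeriv i w x +
          partialDeriv j w x * partialDeriv k (partialDeriv i w) x +
          partialDeriv k w x * partialDeriv j (partialDeriv i w) x) +
        deriv φ (w x) * partialDeriv k (partialDeriv j (partialDeriv i w)) x := by
  have hφ' := contDiffOn_deriv_of_isOpen hφ hV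
  have hφ'' := contDiffOn_deriv_of_isOpen hφ' hV
  have h1 : IsSmooth (fun y => deriv φ (w y)) := IsSmooth.comp_of_contDiffOn hφ' hw hwV
  have h2 : IsSmooth (fun y => deriv (deriv φ) (w y)) := IsSmooth.comp_of_contDiffOn hφ'' hw hwV
  have hwi := hw.partialDeriv i
  have hwj := hw.partialDeriv j
  have hwji := hwi.partialDeriv j
  rw [partialDeriv₂_comp_fun hφ hV hw hwV i j]
  have hA : IsSmooth (fun x => deriv (deriv φ) (w x) * partialDeriv j w x * partialDeriv i w x) :=
    (ContDiff.mul (ContDiff.mul h2 hwj) hwi :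
      IsSmooth fun x => deriv (deriv φ) (w x) * partialDeriv j w x * partialDeriv i w x)
  have hB : IsSmooth (fun x => deriv φ (w x) * partialDeriv j (partialDeriv i w) x) :=
    (ContDiff.mul h1 hwji : IsSmooth fun x => deriv φ (w x) * partialDeriv j (partialDeriv i w) x)
  have e : (fun x => deriv (deriv φ) (w x) * partialDeriv j w x * partialDeriv i w x +
      deriv φ (w x) * partialDeriv j (partialDeriv i w) x) =
      (fun x => deriv (deriv φ) (w x) * partialDeriv j w x * partialDeriv i w x) +
        fun x => deriv φ (w x) * partialDeriv j (partialDeriv i w) x := by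
    funext x; simp only [Pi.add_apply]
  rw [e, partialDeriv_add (hA.isContDiff (by simp)) (hB.isContDiff (by simp)), Pi.add_apply]
  have h2w : IsSmooth (fun x => deriv (deriv φ) (w x) * partialDeriv j w x) :=
    (ContDiff.mul h2 hwj : IsSmooth fun x => deriv (deriv φ) (w x) * partialDeriv j w x)
  rw [show partialDeriv k (fun x => deriv (deriv φ) (w x) * partialDeriv j w x * partialDeriv i w x) x = _
      from partialDeriv_mul (h2w.isContDiff (by simp)) (hwi.isContDiff (by simp)) k x,
    show partialDeriv k (fun x => deriv (deriv φ) (w x) * partialDeriv j w x) x = _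
      from partialDeriv_mul (h2.isContDiff (by simp)) (hwj.isContDiff (by simp)) k x,
    show partialDeriv k (fun x => deriv φ (w x) * partialDeriv j (partialDeriv i w) x) x = _
      from partialDeriv_mul (h1.isContDiff (by simp)) (hwji.isContDiff (by simp)) k x,
    partialDeriv_comp_of_contDiffOn hφ'' hV hw hwV k x, partialDeriv_comp_of_contDiffOn hφ' hV hw hwV k x]
  ring

/-! ### Pointwise bounds -/

/-- First-order bound: `|∂ᵢ(φ ∘ w)(x)| ≤ C₁ |∂ᵢw(x)|` if `|φ'| ≤ C₁` on the range. [folklore] -/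
theorem abs_partialDeriv_comp_le (hφ : ContDiffOn ℝ ∞ φ V) (hV : IsOpen V) (hw : IsSmooth w)
    (hwV : ∀ x, w x ∈ V) {C₁ : ℝ} (hC₁ : ∀ x, |deriv φ (w x)| ≤ C₁) (i : d) (x : UnitAddTorus d) :
    |partialDeriv i (fun z => φ (w z)) x| ≤ C₁ * |partialDeriv i w x| := by
  rw [partialDeriv_comp_of_contDiffOn hφ hV hw hwV i x, abs_mul]
  exact mul_le_mul_of_nonneg_right (hC₁ x) (abs_nonneg _)

/-- Second-order bound:
`|∂ⱼ∂ᵢ(φ ∘ w)| ≤ C₂ |∂ⱼw| |∂ᵢw| + C₁ |∂ⱼ∂ᵢw|` if `|φ'| ≤ C₁`, `|φ''| ≤ C₂` on the range. [folklore] -/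
theorem abs_partialDeriv₂_comp_le (hφ : ContDiffOn ℝ ∞ φ V) (hV : IsOpen V) (hw : IsSmooth w)
    (hwV : ∀ x, w x ∈ V) {C₁ C₂ : ℝ} (hC₁ : ∀ x, |deriv φ (w x)| ≤ C₁)
    (hC₂ : ∀ x, |deriv (deriv φ) (w x)| ≤ C₂) (i j : d) (x : UnitAddTorus d) :
    |partialDeriv j (partialDeriv i (fun z => φ (w z))) x| ≤
      C₂ * (|partialDeriv j w x| * |partialDeriv i w x|) + C₁ * |partialDeriv j (partialDeriv i w) x| := by
  rw [partialDeriv₂_comp hφ hV hw hwV i j x]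
  refine (abs_add_le _ _).trans (add_le_add ?_ ?_)
  · rw [abs_mul, abs_mul, mul_assoc]
    exact mul_le_mul_of_nonneg_right (hC₂ x) (by positivity)
  · rw [abs_mul]
    exact mul_le_mul_of_nonneg_right (hC₁ x) (abs_nonneg _)

/-- Third-order bound:
`|∂ₖ∂ⱼ∂ᵢ(φ ∘ w)| ≤ C₃ |∂ₖw||∂ⱼw||∂ᵢw| + C₂ (|∂ₖ∂ⱼw||∂ᵢw| + |∂ⱼw||∂ₖ∂ᵢw| + |∂ₖw||∂ⱼ∂ᵢw|) + C₁ |∂ₖ∂ⱼ∂ᵢw|`.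
[folklore] -/
theorem abs_partialDeriv₃_comp_le (hφ : ContDiffOn ℝ ∞ φ V) (hV : IsOpen V) (hw : IsSmooth w)
    (hwV : ∀ x, w x ∈ V) {C₁ C₂ C₃ : ℝ} (hC₁ : ∀ x, |deriv φ (w x)| ≤ C₁)
    (hC₂ : ∀ x, |deriv (deriv φ) (w x)| ≤ C₂) (hC₃ : ∀ x, |deriv (deriv (deriv φ)) (w x)| ≤ C₃)
    (i j k : d) (x : UnitAddTorus d) :
    |partialDeriv k (partialDeriv j (partialDeriv i (fun z => φ (w z)))) x| ≤
      C₃ * (|partialDeriv k w x| * |partialDeriv j w x| * |partialDeriv i w x|) +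
        C₂ * (|partialDeriv k (partialDeriv j w) x| * |partialDeriv i w x| +
          |partialDeriv j w x| * |partialDeriv k (partialDeriv i w) x| +
          |partialDeriv k w x| * |partialDeriv j (partialDeriv i w) x|) +
        C₁ * |partialDeriv k (partialDeriv j (partialDeriv i w)) x| := by
  rw [partialDeriv₃_comp hφ hV hw hwV i j k x]
  refine (abs_add_le _ _).trans (add_le_add ((abs_add_le _ _).trans (add_le_add ?_ ?_)) ?_)
  · rw [abs_mul, abs_mul, abs_mul, mul_assoc, mul_assoc, ← mul_assoc |partialDeriv k w x|]
    exact mul_le_mul_of_nonneg_right (hC₃ x) (by positivity)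
  · rw [abs_mul]
    have hC₂0 : 0 ≤ C₂ := (abs_nonneg _).trans (hC₂ x)
    have hP : |partialDeriv k (partialDeriv j w) x * partialDeriv i w x +
          partialDeriv j w x * partialDeriv k (partialDeriv i w) x +
          partialDeriv k w x * partialDeriv j (partialDeriv i w) x| ≤
        |partialDeriv k (partialDeriv j w) x| * |partialDeriv i w x| +
          |partialDeriv j w x| * |partialDeriv k (partialDeriv i w) x| +
          |partialDeriv k w x| * |partialDeriv j (partialDeriv i w) x| := by
      rw [← abs_mul, ← abs_mul, ← abs_mul]
      exact abs_add_three _ _ _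
    exact (mul_le_mul_of_nonneg_right (hC₂ x) (abs_nonneg _)).trans
      (mul_le_mul_of_nonneg_left hP hC₂0)
  · rw [abs_mul]
    exact mul_le_mul_of_nonneg_right (hC₁ x) (abs_nonneg _)

end Chain

end Torus

end Literature.Analysis.FunctionSpaces

end
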